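import Summits.ResolutionOfSingularities.ResolutionOfSingularities.Theorems.EquisingularLiftEquisingularLiftSectionBlowupGoodAt
import Summits.ResolutionOfSingularities.ResolutionOfSingularities.Theorems.EquisingularLiftEquisingularLiftCentreBlowupFlatExceptional
import Literature.AlgebraicGeometry.Resolution.BlowupsRelativeCartier
import HarnessLib

/-!
# `EquisingularLift`, line `strata-split` — blowing up a regular flat centre with regular special fibre keeps good reduction

Crux `stmt-ResolutionOfSingularities-15660` = `Theses.EquisingularLift.EquisingularLift`; CURVE-CENTRE layer (H4 of
`L/w45b/CHAIN.md` §5) of the blow-up calculus over a DVR, generalising the section case `goodAt_of_isBlowup_section`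
(`…SectionBlowupGoodAt`, centre `C = s(Spec O)`) to an arbitrary regular `O`-flat centre whose special fibre is
regular.

Setting: `O` a discrete valuation ring with residue field `κ`, `U` an integral scheme SMOOTH over `Spec O` (`r`),
`K` an ideal sheaf on `U` with `C = V(K)` regular and flat over `Spec O` and with regular special fibre
`C_κ = V(K · 𝒪_{U_κ}) ⊆ U_κ = U ×_{Spec O} Spec κ`, and `τ : U' → U` a blow-up of `U` along `K`. CLAIM
(`goodAt_of_isBlowup_regularCentre`): at EVERY point `w ∈ U'` the blown-up ambient has good reduction,
`GoodAt (τ ≫ r) w` — `𝒪_{U',w}` is regular and the germ of the uniformizer is a regular parameter (`∉ 𝔪_w²`).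

Proof (as in the section case, fed by the curve-centre flatness `flat_exceptional_of_isBlowup_regularCentre_of_smooth`):
(1) `U'` is regular (Liu 8.1.19 (a), `IsBlowup.isRegular_of_isRegular_subscheme`: `U` regular locally Noetherian,
`V(K)` regular); (2) the germ of `ϖ` at `w` is non-zero (injectivity of the stalk maps of a blow-up of an integral
scheme, `IsBlowup.stalkMap_injective`, and `ϖ ∉ 𝔪²` on the smooth `U`, `stub_goodAtOfSmooth`); (3) the special fibre
`U' ×_{Spec O} Spec κ ≅ U' ×_U U_κ` is the blow-up of the regular `U_κ` along `K · 𝒪_{U_κ}` (the exceptional divisor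
being flat over `O`: `IsBlowup.pullback_snd_of_flat_exceptional`, Stacks 0805), whose centre `C_κ` is regular, hence
it is regular (Liu 8.1.19 (a) again); (4) `goodAt_of_isRegularLocalRing_fibre`.

* `isRegular_subscheme_comap_of_isOpenImmersion` — `V(K · 𝒪_V)` is regular if `V(K)` is, for an open immersion
  `V → X`;
* `goodAt_of_isBlowup_regularCentre` — the claim (ambient `U` smooth and integral);
* `goodAt_of_isBlowup_regularCentre_of_opens` — the form over an integral `X'` which is smooth over `O` only on an
  open `U ⊇` (special fibre of the centre), as in the section file: good reduction at every point of `X''` over `U`.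

References: Q. Liu, *Algebraic Geometry and Arithmetic Curves*, OUP 2002, Thm. 8.1.19; A. Grothendieck,
J. Dieudonné, *EGA IV₄*, Publ. Math. IHÉS 32 (1967), Prop. 17.5.8 (iii); The Stacks Project, Tag 0805.
-/

set_option linter.dupNamespace false -- mandated namespace `Summit.<Summit>.<Problem>` of this single-conjunct summit
set_option linter.overlappingInstances false -- the signatures carry both [IsDomain O] and [IsDiscreteValuationRing O]

noncomputable section

namespace Summit.ResolutionOfSingularities.ResolutionOfSingularities.Cruxes.EquisingularLift.StrataSplit

open CategoryTheory CategoryTheory.Limits AlgebraicGeometry TopologicalSpace Topology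
open IsLocalRing Literature.AlgebraicGeometry.Resolution
open Summit.ResolutionOfSingularities.ResolutionOfSingularities.Theses.EquisingularLift.Split

universe u

/-! ## Regular centres restrict to regular centres on opens -/

/-- **`V(K · 𝒪_V)` is regular when `V(K)` is**, for an open immersion `f : V → X`: `V(K · 𝒪_V) ≅ V ×_X V(K)`
(Mathlib's `comapIso`) is an open subscheme of `V(K)`. [folklore] -/
theorem isRegular_subscheme_comap_of_isOpenImmersion {V X : Scheme.{u}} (f : V ⟶ X) [IsOpenImmersion f]
    (K : X.IdealSheafData) (hK : Scheme.IsRegular K.subscheme) :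
    Scheme.IsRegular (K.comap f).subscheme :=
  Scheme.IsRegular.of_isOpenImmersion ((K.comapIso f).hom ≫ pullback.snd f K.subschemeι) hK

/-! ## The local statement: `U` itself smooth over `Spec O` -/

/-- **The blow-up of a smooth integral `O`-scheme along a regular flat centre with regular special fibre has good
reduction everywhere.** Let `O` be a discrete valuation ring with residue field `κ`, `U` integral with
`r : U → Spec O` smooth, `K` an ideal sheaf on `U` with `V(K)` regular and flat over `Spec O` and with
`V(K · 𝒪_{U_κ})` regular (`U_κ = U ×_{Spec O} Spec κ`), `τ : U' → U` a blow-up along `K`, and `w ∈ U'`. Then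
`GoodAt (τ ≫ r) w`: (1) `U'` is regular (Liu 8.1.19 (a)); (2) the germ of a uniformizer `ϖ` at `w` is non-zero
(image of the germ at `τ w`, which lies outside `𝔪²` as `U` is smooth over `O`, under the injective stalk map of the
blow-up); (3) the special fibre of `U'` is `U' ×_U U_κ`, the blow-up of the regular `U_κ` along the regular
`V(K · 𝒪_{U_κ})` (the exceptional divisor being flat over `O`), hence regular. [cite: Liu2002, Thm. 8.1.19] -/
theorem goodAt_of_isBlowup_regularCentre : ∀ (O : Type) [CommRing O] [IsDomain O] [IsDiscreteValuationRing O] (U U' : AlgebraicGeometry.Scheme.{0}) [AlgebraicGeometry.IsIntegral U] (r : U ⟶ AlgebraicGeometry.Spec (.of O)) [AlgebraicGeometry.Smooth r] (K : U.IdealSheafData), Literature.AlgebraicGeometry.Resolution.Scheme.IsRegular K.subscheme → AlgebraicGeometry.Flat (CategoryTheory.CategoryStruct.comp K.subschemeι r) → Literature.AlgebraicGeometry.Resolution.Scheme.IsRegular (K.comap (CategoryTheory.Limits.pullback.fst r (AlgebraicGeometry.Spec.map (CommRingCat.ofHom (IsLocalRing.residue O))))).subscheme → ∀ (τ : U' ⟶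 U), Literature.AlgebraicGeometry.Resolution.IsBlowup τ K → ∀ w : U', Summit.ResolutionOfSingularities.ResolutionOfSingularities.Theses.EquisingularLift.Split.GoodAt (CategoryTheory.CategoryStruct.comp τ r) w := by
  intro O _ _ _ U U' _ r _ K hZreg hflat0 hZκ τ hτ w
  -- adapted from `goodAt_of_isBlowup_section_local` (section case, same line)
  -- `U` is locally Noetherian and regular
  haveI : IsLocallyNoetherian U := LocallyOfFiniteType.isLocallyNoetherian r
  haveI : IsRegularRing (CommRingCat.of O) := inferInstanceAs (IsRegularRing O)
  have hUreg : Scheme.IsRegular U := Scheme.IsRegular.of_smooth r (Scheme.isRegular_Spec (.of O))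
  -- (1) `U'` is regular (Liu 8.1.19 (a))
  have hU'reg : Scheme.IsRegular U' := hτ.isRegular_of_isRegular_subscheme hUreg hZreg
  -- (2) the germ at `w` of a uniformizer is non-zero
  have hne : ∀ ϖ : O, Irreducible ϖ → (U'.presheaf.Γgerm w).hom
      ((τ ≫ r).appTop.hom ((Scheme.ΓSpecIso (CommRingCat.of O)).inv.hom ϖ)) ≠ 0 := by
    intro ϖ hϖ h0
    apply (stub_goodAtOfSmooth O U r ‹_› (τ w)).2 ϖ hϖ
    have h1 : (τ.stalkMap w).hom ((U.presheaf.Γgerm (τ w)).hom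
        (r.appTop.hom ((Scheme.ΓSpecIso (CommRingCat.of O)).inv.hom ϖ))) = 0 := by
      rw [stalkMap_Γgerm_apply', ← h0, Scheme.Hom.comp_appTop, CommRingCat.hom_comp,
        RingHom.comp_apply]
    rw [hτ.stalkMap_injective w (h1.trans (map_zero _).symm)]
    exact Ideal.zero_mem _
  -- (3) the special fibre `U' ×_{Spec O} Spec κ ≅ U' ×_U U_κ` is regular
  haveI : IsLocallyNoetherian ↑(pullback r (Spec.map (CommRingCat.ofHom (residue O)))) :=
    LocallyOfFiniteType.isLocallyNoetherian
      (pullback.snd r (Spec.map (CommRingCat.ofHom (residue O))))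
  -- the exceptional divisor is flat over `O`, so the base change of `τ` to `U_κ` is the blow-up along `K · 𝒪_{U_κ}`
  haveI hflatE := flat_exceptional_of_isBlowup_regularCentre_of_smooth O U U' r K hZreg hflat0 τ hτ
  have hBs : IsBlowup (pullback.snd τ (pullback.fst r (Spec.map (CommRingCat.ofHom (residue O)))))
      (K.comap (pullback.fst r (Spec.map (CommRingCat.ofHom (residue O))))) :=
    hτ.pullback_snd_of_flat_exceptional (ResidueField O) r
  -- `U_κ` is regular (smooth over a field), hence so is its blow-up along the regular `V(K · 𝒪_{U_κ})`
  have hUκreg : Scheme.IsRegular ↑(pullback r (Spec.map (CommRingCat.ofHom (residue O)))) :=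
    fun z => isRegularLocalRing_stalk_of_smooth_of_field
      (pullback.snd r (Spec.map (CommRingCat.ofHom (residue O)))) z
  have hfibreg := hBs.isRegular_of_isRegular_subscheme hUκreg hZκ
  have hfib : Scheme.IsRegular
      ↑(pullback (τ ≫ r) (Spec.map (CommRingCat.ofHom (residue O)))) :=
    Scheme.IsRegular.of_isOpenImmersion
      (pullbackRightPullbackFstIso r (Spec.map (CommRingCat.ofHom (residue O))) τ).inv hfibreg
  -- (4) assemble
  exact goodAt_of_isRegularLocalRing_fibre O U' (τ ≫ r) w (hU'reg w) hne (fun z _ => hfib z)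

/-! ## The form with a smooth open of an integral ambient -/

/-- **`goodAt_of_isBlowup_regularCentre_of_opens`.** Let `O` be a discrete valuation ring with residue field `κ`,
`X'` integral over `Spec O` (`r'`), `U ⊆ X'` an open which is smooth over `Spec O`, `K` an ideal sheaf on `X'` with
`V(K)` regular and flat over `Spec O` and with regular special fibre `V(K · 𝒪_{X'_κ}) ⊆ X'_κ = X' ×_{Spec O} Spec κ`,
and `τ : X'' → X'` a blow-up along `K`. Then the blown-up ambient has good reduction at every `w ∈ X''` over `U`.
Reduction to `goodAt_of_isBlowup_regularCentre`: all three hypotheses on the centre restrict to the centre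
`K · 𝒪_U` of the blow-up `τ|_U` of `U` (`IsBlowup.restrict`; `U_κ → X'_κ` is an open immersion), and good reduction
is unchanged along the open immersion `τ⁻¹(U) ↪ X''` (`stub_goodAtOverIso`). [cite: Liu2002, Thm. 8.1.19] -/
theorem goodAt_of_isBlowup_regularCentre_of_opens : ∀ (O : Type) [CommRing O] [IsDomain O] [IsDiscreteValuationRing O] (X' X'' : AlgebraicGeometry.Scheme.{0}) [AlgebraicGeometry.IsIntegral X'] (r' : X' ⟶ AlgebraicGeometry.Spec (.of O)) (U : X'.Opens), AlgebraicGeometry.Smooth (CategoryTheory.CategoryStruct.comp U.ι r') → ∀ (K : X'.IdealSheafData), Literature.AlgebraicGeometry.Resolution.Scheme.IsRegular K.subscheme → AlgebraicGeometry.Flat (CategoryTheory.CategoryStruct.comp K.subschemeι r') → Literature.AlgebraicGeometry.Resolution.Scheme.IsRegular (K.comap (CategoryTheory.Limits.pullback.fst r' (AlgebraicGeometry.Spec.map (CommRingCat.ofHom (IsLocalRing.residue O))))).subscheme → ∀ (τ : X'' ⟶ X'), Literature.AlgebraicGeometry.Resolution.IsBlowup τ K → ∀ w : X'', τ w ∈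 U → Summit.ResolutionOfSingularities.ResolutionOfSingularities.Theses.EquisingularLift.Split.GoodAt (CategoryTheory.CategoryStruct.comp τ r') w := by
  intro O _ _ _ X' X'' _ r' U hsm K hZreg hflat0 hZκ τ hτ w hwU
  haveI : Smooth (U.ι ≫ r') := hsm
  haveI := hflat0
  haveI : Nonempty (U : Scheme.{0}) := ⟨⟨_, hwU⟩⟩
  haveI : IsIntegral (U : Scheme.{0}) := isIntegral_of_isOpenImmersion U.ι
  -- the hypotheses restrict to the centre `K · 𝒪_U` of `τ|_U`
  have hZU : Scheme.IsRegular (K.comap U.ι).subscheme := isRegular_subscheme_comap_of_isOpenImmersion U.ι K hZreg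
  have hflatU : Flat ((K.comap U.ι).subschemeι ≫ U.ι ≫ r') := flat_comap_subschemeι_comp U.ι K r'
  -- the open immersion `U_κ → X'_κ` over `U ↪ X'`
  set ικ := Spec.map (CommRingCat.ofHom (residue O)) with hικ
  let j : ↑(pullback (U.ι ≫ r') ικ) ⟶ ↑(pullback r' ικ) :=
    (pullbackRightPullbackFstIso r' ικ U.ι).inv ≫ pullback.snd U.ι (pullback.fst r' ικ)
  have hj : j ≫ pullback.fst r' ικ = pullback.fst (U.ι ≫ r') ικ ≫ U.ι := by
    simp only [j, Category.assoc, pullbackRightPullbackFstIso_inv_snd_fst]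
  haveI : IsOpenImmersion j := by
    simp only [j]; infer_instance
  have hZκU : Scheme.IsRegular ((K.comap U.ι).comap (pullback.fst (U.ι ≫ r') ικ)).subscheme := by
    rw [← Scheme.IdealSheafData.comap_comp, ← hj, Scheme.IdealSheafData.comap_comp]
    exact isRegular_subscheme_comap_of_isOpenImmersion j _ hZκ
  -- the blow-up restricted over `U`
  have hτU : IsBlowup (τ ∣_ U) (K.comap U.ι) := hτ.restrict U
  have hgood := goodAt_of_isBlowup_regularCentre O U _ (U.ι ≫ r') (K.comap U.ι) hZU hflatU hZκU
    (τ ∣_ U) hτU ⟨w, hwU⟩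
  -- move to `X''` along the open immersion `τ⁻¹(U) ↪ X''`
  -- adapted from `goodAt_of_isBlowup_section` (section case, same line)
  haveI := isIso_ι_morphismRestrict_self (τ ⁻¹ᵁ U)
  have key := stub_goodAtOverIso X'' _ (τ ⁻¹ᵁ U).ι (τ ⁻¹ᵁ U) inferInstance ⟨w, hwU⟩ w rfl hwU O
    (τ ≫ r')
  rw [← morphismRestrict_ι_assoc] at key
  exact key.mp hgood

end Summit.ResolutionOfSingularities.ResolutionOfSingularities.Cruxes.EquisingularLift.StrataSplit

end
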